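import Mathlib
import Summits.Ventures.PercRepro.TriangleCapFourRowThreeCap

/-!
# PercRepro — THE CAP ON THE CELL `(k, 4, 3)` IS STRICT: a `K₄⁻`-free graph with `4 (k − 4) − 3` edges on `k ≥ 11`
vertices with a vertex of degree `k − 4` is `4`-bipartite or at least `B2 + 2 = 2k − 16` below the closed form
(p3, gen 46; part 199k)

Part 199b's count at `M = 1` has `P = Σ_{u ∈ R} degIn N u = 3K − 4`, which is not a multiple of `3`; so some `y ∈ N`
has `g = degIn R y ∈ {1, 2}`, where `(1 + f + g)² + 2 ≤ 1 + 3f + 5g + 2fg` (`cap_sq_bound_strict`), and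
`Σ_N d² ≤ K + 10 + 5P`: the cap graphs are at least `2k − 16 = T` below the closed form — the one-triangle family
`T` on `(k, 4, 3)` (`tFamilyGen (k − 1) 4 1`) is a cap graph, so this is sharp. Needed for the equality locus of
part 199m: no cap graph attains `B2`. Axioms: standard.
-/

namespace PercRepro

namespace TriangleCap

namespace C047

open Finset

variable {V : Type*} [Fintype V] [DecidableEq V]

/-- `(1 + f + g)² + 2 ≤ 1 + 3f + 5g + 2fg` for `f ≤ 1` and `g ∈ {1, 2}`. -/
theorem cap_sq_bound_strict (f g : ℕ) (hf : f ≤ 1) (hg : g = 1 ∨ g = 2) :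
    (1 + f + g) * (1 + f + g) + 2 ≤ 1 + 3 * f + 5 * g + 2 * (f * g) := by
  interval_cases f <;> rcases hg with rfl | rfl <;> norm_num

/-- **THE STRICT ARITHMETIC OF THE CASE `M = 1`:** with `S_N ≤ K + 10 + 5P` the count closes `2` below. -/
theorem four_three_cap_sq_arith_strict (K P SN SR m : ℕ) (hK : 7 ≤ K) (hm : m + 3 = 4 * K) (hP : P + 4 = 3 * K)
    (hSN : SN + 2 ≤ K + 12 + 5 * P) (hSR : SR + 8 * K ≤ 3 * (K * K) + 6) :
    K * K + SN + SR + 3 * (K + 4 - 4) + (2 * (K + 4) - 18) + 2 ≤ m * (K + 4) := by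
  obtain ⟨t, rfl⟩ : ∃ t, K = t + 7 := ⟨K - 7, by omega⟩
  have hP' : P = 3 * t + 17 := by omega
  have hm' : m = 4 * t + 25 := by omega
  subst hP' hm'
  have e1 : t + 7 + 4 - 4 = t + 7 := by omega
  have e2 : 2 * (t + 7 + 4) - 18 = 2 * t + 4 := by omega
  rw [e1, e2]
  nlinarith [hSN, hSR]

/-- **THE CAP ON THE CELL `(k, 4, 3)` IS STRICT, `k ≥ 11`:** a `K₄⁻`-free graph with `4 (k − 4) − 3` edges and a
vertex `x` of degree `k − 4` is a spanning subgraph of some `K(A, Aᶜ)` with `|A| = 4`, or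
`Σ_v d(v)² + 3 (k − 4) + (2k − 18) + 2 ≤ m k`. -/
theorem four_three_cap_strict (D : SimpleGraph V) [DecidableRel D.Adj] (hK : K4mFree D)
    (hk : 11 ≤ Fintype.card V) (hm : D.edgeFinset.card + 3 = 4 * (Fintype.card V - 4)) (x : V)
    (hx : deg D x + 4 = Fintype.card V) :
    (∃ A : Finset V, A.card = 4 ∧ BipSub D A) ∨
      ∑ v, deg D v * deg D v + 3 * (Fintype.card V - 4) + (2 * Fintype.card V - 18) + 2 ≤
        D.edgeFinset.card * Fintype.card V := by
  obtain ⟨N, hN⟩ : ∃ N : Finset V, N = univ.filter (fun w => D.Adj x w) := ⟨_, rfl⟩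
  have hmemN : ∀ w, w ∈ N ↔ D.Adj x w := fun w => by rw [hN, mem_filter]; simp only [mem_univ, true_and]
  have hxN : x ∉ N := fun h => D.irrefl ((hmemN x).mp h)
  have hdx : deg D x = N.card := by rw [hN]; rfl
  obtain ⟨K, hKdef⟩ : ∃ K, N.card = K := ⟨_, rfl⟩
  have hcardV : Fintype.card V = K + 4 := by omega
  obtain ⟨m, hmdef⟩ : ∃ m, D.edgeFinset.card = m := ⟨_, rfl⟩
  rw [hmdef, hcardV, Nat.add_sub_cancel] at hm
  -- the non-neighbours `R`, `|R| = 3`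
  obtain ⟨R, hR⟩ : ∃ R : Finset V, R = (insert x N)ᶜ := ⟨_, rfl⟩
  have hRcard : R.card = 3 := by
    rw [hR, card_compl, card_insert_of_notMem hxN]
    omega
  have hmemR : ∀ w, w ∈ R ↔ w ≠ x ∧ ¬ D.Adj x w := by
    intro w
    rw [hR, mem_compl, mem_insert, hmemN]
    tauto
  -- the matching inside `N`
  obtain ⟨M, hM⟩ : ∃ M, adjPairs D N = 2 * M := ⟨_, adjPairs_eq_two_mul D N⟩
  have hTf : ∑ y ∈ N, degIn D N y = 2 * M := by rw [← adjPairs_eq_sum_degIn, hM]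
  -- `P = Σ_{u ∈ R} degIn N u`, `E = adjPairs R`
  obtain ⟨P, hPdef⟩ : ∃ P, ∑ u ∈ R, degIn D N u = P := ⟨_, rfl⟩
  obtain ⟨E, hEdef⟩ : ∃ E, adjPairs D R = E := ⟨_, rfl⟩
  -- the degree sum over `{x} ∪ N ∪ R`
  have hsplit : ∀ F : V → ℕ, ∑ w, F w = F x + ∑ y ∈ N, F y + ∑ u ∈ R, F u := by
    intro F
    rw [← sum_add_sum_compl (insert x N), sum_insert hxN, ← hR]
  have hdegN : ∀ y ∈ N, deg D y = 1 + degIn D N y + degIn D R y := by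
    intro y hy
    have := deg_eq_of_mem_nbhd D x y ((hmemN y).mp hy)
    rw [← hN, ← hR] at this
    exact this
  have hsumN : ∑ y ∈ N, deg D y = K + 2 * M + P := by
    rw [sum_congr rfl hdegN, sum_add_distrib, sum_add_distrib, sum_const, smul_eq_mul, mul_one, hKdef, hTf,
      sum_degIn_comm D N R, hPdef]
  have hdegR : ∀ u ∈ R, deg D u = degIn D N u + degIn D R u := by
    intro u hu
    have := deg_eq_of_not_mem_nbhd D x u ((hmemR u).mp hu).2
    rw [← hN, ← hR] at this
    exact this
  have hsumR : ∑ u ∈ R, deg D u = P + E := by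
    rw [sum_congr rfl hdegR, sum_add_distrib, hPdef, ← adjPairs_eq_sum_degIn, hEdef]
  have hdegsum := sum_deg_eq D
  rw [hsplit, hsumN, hsumR, hdx, hKdef, hmdef] at hdegsum
  -- (2) every vertex of `R` has at most `K − M` neighbours in `N` (one end of each matching edge)
  have hPle : ∀ u ∈ R, degIn D N u + M ≤ K := by
    intro u hu
    have := two_mul_degIn_add_adjPairs_le D hK (x := x) ((hmemR u).mp hu).1
    rw [← hN, hM, hKdef] at this
    omega
  have h2 : P + 3 * M ≤ 3 * K := by
    have hs : ∑ u ∈ R, (degIn D N u + M) ≤ ∑ _u ∈ R, K := sum_le_sum hPle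
    rw [sum_add_distrib, sum_const, sum_const, smul_eq_mul, smul_eq_mul, hPdef, hRcard] at hs
    exact hs
  -- (3) `E ≤ 6`
  have hE6 : E ≤ 6 := by
    have := adjPairs_le_card_mul_pred D R
    rw [hEdef, hRcard] at this
    exact this
  -- (4) an edge inside `R` is impossible
  have hnoedge : 1 ≤ E → (E ≤ 4 ∧ P + M ≤ 2 * K + 1) ∨ P + M ≤ 2 * K := by
    intro hE
    have := four_three_noedge D hK x N R hmemN hmemR hRcard K M hKdef hPle (by rw [hEdef]; exact hE)
    rw [hEdef, hPdef] at this
    exact this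
  -- (5) `E = 0`, `M ≤ 1`
  obtain ⟨hE0, hM1⟩ := four_three_cap_count K M P E m hdegsum hm h2 hE6 (by omega) hnoedge
  -- no edge inside `R`
  have hnoR : ∀ u ∈ R, degIn D R u = 0 := by
    intro u hu
    have hle : degIn D R u ≤ ∑ z ∈ R, degIn D R z := single_le_sum (fun _ _ => Nat.zero_le _) hu
    rw [← adjPairs_eq_sum_degIn, hEdef, hE0] at hle
    exact Nat.le_zero.mp hle
  rcases Nat.eq_zero_or_pos M with hM0 | hMpos
  · -- `M = 0`: no edge inside `N`, none inside `R`: `D ⊆ K(Nᶜ, N)`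
    left
    have hnoN : ∀ y ∈ N, ∀ y', D.Adj y y' → y' ∉ N := by
      intro y hy y' hyy' hy'
      have h0 : degIn D N y = 0 := by
        have hle : degIn D N y ≤ ∑ z ∈ N, degIn D N z := single_le_sum (fun _ _ => Nat.zero_le _) hy
        rw [hTf, hM0, mul_zero] at hle
        exact Nat.le_zero.mp hle
      unfold degIn at h0
      rw [card_eq_zero, filter_eq_empty_iff] at h0
      exact h0 hy' hyy'
    have hnoR' : ∀ u ∈ R, ∀ u', D.Adj u u' → u' ∉ R := by
      intro u hu u' huu' hu'
      have h0 := hnoR u hu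
      unfold degIn at h0
      rw [card_eq_zero, filter_eq_empty_iff] at h0
      exact h0 hu' huu'
    refine ⟨Nᶜ, ?_, ?_⟩
    · rw [card_compl, hKdef]
      omega
    · intro p q hpq
      rw [mem_compl, mem_compl, not_not]
      constructor
      · intro hpN
        by_contra hqN
        by_cases hpx : p = x
        · subst hpx
          exact hqN ((hmemN q).mpr hpq)
        by_cases hqx : q = x
        · subst hqx
          exact hpN ((hmemN p).mpr (D.adj_symm hpq))
        have hpR : p ∈ R := (hmemR p).mpr ⟨hpx, fun h => hpN ((hmemN p).mpr h)⟩
        have hqR : q ∈ R := (hmemR q).mpr ⟨hqx, fun h => hqN ((hmemN q).mpr h)⟩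
        exact hnoR' p hpR q hpq hqR
      · intro hqN hpN
        exact hnoN p hpN q hpq hqN
  · -- `M = 1`: the one-triangle structure with `P = 3K − 4`
    right
    have hM1' : M = 1 := by omega
    subst hM1'
    have hP : P + 4 = 3 * K := by omega
    -- `Σ_R d² = 3K² − 8K + 6` exactly: the three values are `K − 1, K − 1, K − 2`
    have hSR : ∑ u ∈ R, deg D u * deg D u + 8 * K ≤ 3 * (K * K) + 6 := by
      obtain ⟨u, v, w, huv, huw, hvw, hR3⟩ := card_eq_three.mp hRcard
      have hsum3 : ∀ f : V → ℕ, ∑ t ∈ R, f t = f u + f v + f w := by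
        intro f
        rw [hR3, sum_insert, sum_insert, sum_singleton, add_assoc]
        · rw [mem_singleton]; exact hvw
        · rw [mem_insert, mem_singleton]; push Not; exact ⟨huv, huw⟩
      have hmemR3 : ∀ t, t ∈ R ↔ t = u ∨ t = v ∨ t = w := by
        intro t
        rw [hR3, mem_insert, mem_insert, mem_singleton]
      have hdu : deg D u = degIn D N u := by
        rw [hdegR u ((hmemR3 u).mpr (Or.inl rfl)), hnoR u ((hmemR3 u).mpr (Or.inl rfl)), add_zero]
      have hdv : deg D v = degIn D N v := by
        rw [hdegR v ((hmemR3 v).mpr (Or.inr (Or.inl rfl))), hnoR v ((hmemR3 v).mpr (Or.inr (Or.inl rfl))),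
          add_zero]
      have hdw : deg D w = degIn D N w := by
        rw [hdegR w ((hmemR3 w).mpr (Or.inr (Or.inr rfl))), hnoR w ((hmemR3 w).mpr (Or.inr (Or.inr rfl))),
          add_zero]
      have hsumP : degIn D N u + degIn D N v + degIn D N w + 4 = 3 * K := by
        rw [← hsum3, hPdef]; exact hP
      rw [hsum3, hdu, hdv, hdw]
      exact four_three_R_arith _ _ _ K (by omega) (hPle u ((hmemR3 u).mpr (Or.inl rfl)))
        (hPle v ((hmemR3 v).mpr (Or.inr (Or.inl rfl)))) (hPle w ((hmemR3 w).mpr (Or.inr (Or.inr rfl)))) hsumP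
    have hfg : ∑ y ∈ N, degIn D N y * degIn D R y ≤ 3 := by
      have := two_mul_sum_degIn_mul_degIn_le D hK x R (fun u hu => ((hmemR u).mp hu).1)
      rw [← hN, hM, hRcard] at this
      omega
    -- some `y₀ ∈ N` has `g ∈ {1, 2}`: `P = 3K − 4` is not a multiple of `3`
    have hgle : ∀ y ∈ N, degIn D R y ≤ 3 := fun y _ => by
      have := degIn_le_card D R y
      rw [hRcard] at this
      exact this
    obtain ⟨y₀, hy₀, hg₀⟩ : ∃ y₀ ∈ N, degIn D R y₀ = 1 ∨ degIn D R y₀ = 2 := by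
      by_contra hcon
      push Not at hcon
      have hdvd : 3 ∣ ∑ y ∈ N, degIn D R y := by
        apply dvd_sum
        intro y hy
        have h1 := hcon y hy
        have h2 := hgle y hy
        have : degIn D R y = 0 ∨ degIn D R y = 3 := by omega
        rcases this with h | h <;> simp [h]
      rw [sum_degIn_comm D N R, hPdef] at hdvd
      omega
    -- `Σ_N d² + 2 ≤ K + 12 + 5P`
    have hSN : ∑ y ∈ N, deg D y * deg D y + 2 ≤ K + 12 + 5 * P := by
      have hb : ∀ y ∈ N, deg D y * deg D y ≤
          1 + 3 * degIn D N y + 5 * degIn D R y + 2 * (degIn D N y * degIn D R y) := by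
        intro y hy
        rw [hdegN y hy]
        apply cap_sq_bound
        · have h1 := degIn_nbhd_le_one D hK (x := x) (u := y) ((hmemN y).mp hy)
          rw [← hN] at h1
          exact h1
        · exact hgle y hy
      have hb₀ : deg D y₀ * deg D y₀ + 2 ≤
          1 + 3 * degIn D N y₀ + 5 * degIn D R y₀ + 2 * (degIn D N y₀ * degIn D R y₀) := by
        rw [hdegN y₀ hy₀]
        apply cap_sq_bound_strict
        · have h1 := degIn_nbhd_le_one D hK (x := x) (u := y₀) ((hmemN y₀).mp hy₀)
          rw [← hN] at h1
          exact h1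
        · exact hg₀
      have hsum1 : deg D y₀ * deg D y₀ + ∑ y ∈ N.erase y₀, deg D y * deg D y = ∑ y ∈ N, deg D y * deg D y :=
        add_sum_erase N (fun y => deg D y * deg D y) hy₀
      have hsum2 : (1 + 3 * degIn D N y₀ + 5 * degIn D R y₀ + 2 * (degIn D N y₀ * degIn D R y₀)) +
          ∑ y ∈ N.erase y₀, (1 + 3 * degIn D N y + 5 * degIn D R y + 2 * (degIn D N y * degIn D R y)) =
          ∑ y ∈ N, (1 + 3 * degIn D N y + 5 * degIn D R y + 2 * (degIn D N y * degIn D R y)) :=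
        add_sum_erase N
          (fun y => 1 + 3 * degIn D N y + 5 * degIn D R y + 2 * (degIn D N y * degIn D R y)) hy₀
      have hrest : ∑ y ∈ N.erase y₀, deg D y * deg D y ≤
          ∑ y ∈ N.erase y₀, (1 + 3 * degIn D N y + 5 * degIn D R y + 2 * (degIn D N y * degIn D R y)) :=
        sum_le_sum (fun y hy => hb y (mem_of_mem_erase hy))
      have htot : ∑ y ∈ N, (1 + 3 * degIn D N y + 5 * degIn D R y + 2 * (degIn D N y * degIn D R y)) =
          N.card + 3 * ∑ y ∈ N, degIn D N y + 5 * ∑ y ∈ N, degIn D R y +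
            2 * ∑ y ∈ N, degIn D N y * degIn D R y := by
        rw [sum_add_distrib, sum_add_distrib, sum_add_distrib, sum_const, smul_eq_mul, mul_one, mul_sum,
          mul_sum, mul_sum]
      rw [hKdef, hTf, sum_degIn_comm D N R, hPdef] at htot
      have key : ∑ y ∈ N, deg D y * deg D y + 2 ≤
          ∑ y ∈ N, (1 + 3 * degIn D N y + 5 * degIn D R y + 2 * (degIn D N y * degIn D R y)) := by
        rw [← hsum1, ← hsum2]
        omega
      rw [htot] at key
      omega
    rw [hsplit (fun v => deg D v * deg D v), hdx, hKdef, hmdef, hcardV]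
    exact four_three_cap_sq_arith_strict K P _ _ m (by omega) hm hP hSN hSR

end C047

end TriangleCap

end PercRepro
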